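import Mathlib
import Literature.MathematicalPhysics.MHD.SolovevFluxSurfaceLoop
import HarnessLib

/-!
# The printed Lee–Cerfon flux-surface loop traces its flux surface exactly once (proved)

Companion of `SolovevFluxSurfaceLoop.lean`. Lee–Cerfon, Comput. Phys. Commun. 190 (2015) 72–88
(arXiv:1409.3523) §4.1 — bib `LeeCerfon2015` — prints, for the Solov'ev solution (solo2) (`Solovev.psiLC`), the
surface parametrisation `R² = R₀² + 2 r R₀ cos t`, `Z = κ r (R₀/R) sin t` (`Solovev.lcLoop R₀ κ r`). The tree's
definition of the safety factor, Freidberg (6.35) `GradShafranov.safetyFactorE`, takes a parametrised curve and is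
the book's `∮ dl` only under the HYPOTHESIS `GradShafranov.IsFluxSurfaceLoop Ω ψ c γ T` — `γ : [0, T] → Ω` is
differentiable, closed, injective on `[0, T)` and its image is exactly the level set `{ψ = c} ∩ Ω`. This file
DISCHARGES that hypothesis for the printed loop: **`isFluxSurfaceLoop_lcLoop`** — for `0 < r < R₀/2` and
`κ, F_B, q₀ > 0`, `lcLoop R₀ κ r` on `[0, 2π]` traces `{Ψ = cR₀²(r² − a²)} ∩ {R > 0}` exactly once
(`c = κF_B/(2R₀³q₀)`), so `safetyFactorE F_B Ψ (lcLoop R₀ κ r) (2π)` of the companion file IS the safety factor of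
that flux surface in the sense of (6.35). Ingredients: `psiLC_lcLoop` (companion), injectivity of
`t ↦ (cos t, sin t)` on `[0, 2π)`, and the algebraic fact that on `{R > 0}` the level set is the ellipse-like curve
`((R² − R₀²)/(2rR₀))² + (RZ/(κ r R₀))² = 1`.
HONEST FRAMING: exact real analysis about MODEL objects (ideal MHD, Solov'ev profiles, analytic fixed boundary);
nothing here is a stability statement. Typer/prover: gridfusion-model-5 (g2), 2026-08-26.
-/

noncomputable section

namespace Literature.MathematicalPhysics.MHD.Solovev

open GradShafranov _root_.Real Set

/-- Every point of the unit circle is `(cos t, sin t)` for some `t ∈ [0, 2π]`. [folklore] -/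
private theorem tr_exists_cos_sin {X Y : ℝ} (h : X ^ 2 + Y ^ 2 = 1) :
    ∃ t ∈ Icc (0 : ℝ) (2 * π), Real.cos t = X ∧ Real.sin t = Y := by
  have hX1 : -1 ≤ X := by nlinarith [sq_nonneg Y, sq_nonneg (X + 1)]
  have hX2 : X ≤ 1 := by nlinarith [sq_nonneg Y, sq_nonneg (X - 1)]
  have hc : Real.cos (Real.arccos X) = X := Real.cos_arccos hX1 hX2
  have hs : Real.sin (Real.arccos X) = |Y| := by
    rw [Real.sin_arccos, show 1 - X ^ 2 = Y ^ 2 by linarith, Real.sqrt_sq_eq_abs]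
  have h0 := Real.arccos_nonneg X
  have hπ := Real.arccos_le_pi X
  by_cases hY : 0 ≤ Y
  · refine ⟨Real.arccos X, ⟨h0, by linarith [Real.pi_pos]⟩, hc, ?_⟩
    rw [hs, abs_of_nonneg hY]
  · refine ⟨2 * π - Real.arccos X, ⟨by linarith [Real.pi_pos], by linarith⟩, ?_, ?_⟩
    · rw [Real.cos_two_pi_sub, hc]
    · rw [Real.sin_two_pi_sub, hs, abs_of_neg (lt_of_not_ge hY)]; ring

/-- If `cos t₁ = cos t₂` and `sin t₁ = sin t₂` with `t₁, t₂ ∈ [0, 2π)` then `t₁ = t₂`. [folklore] -/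
private theorem tr_angle_inj {t₁ t₂ : ℝ} (h₁ : t₁ ∈ Ico (0 : ℝ) (2 * π)) (h₂ : t₂ ∈ Ico (0 : ℝ) (2 * π))
    (hc : Real.cos t₁ = Real.cos t₂) (hs : Real.sin t₁ = Real.sin t₂) : t₁ = t₂ := by
  have hone : Real.cos (t₁ - t₂) = 1 := by
    rw [Real.cos_sub, hc, hs]
    nlinarith [Real.sin_sq_add_cos_sq t₂]
  obtain ⟨n, hn⟩ := (Real.cos_eq_one_iff (t₁ - t₂)).1 hone
  have hπ : 0 < 2 * π := by positivity
  have hlt : (n : ℝ) * (2 * π) < 1 * (2 * π) := by rw [hn]; linarith [h₁.2, h₂.1]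
  have hgt : (-1 : ℝ) * (2 * π) < (n : ℝ) * (2 * π) := by rw [hn]; linarith [h₁.1, h₂.2]
  have hn1 : (n : ℝ) < 1 := lt_of_mul_lt_mul_right hlt hπ.le
  have hn2 : (-1 : ℝ) < n := lt_of_mul_lt_mul_right hgt hπ.le
  have hn1' : n < 1 := by exact_mod_cast hn1
  have hn2' : -1 < n := by exact_mod_cast hn2
  have hn0 : n = 0 := by omega
  rw [hn0] at hn
  simp only [Int.cast_zero, zero_mul] at hn
  linarith

/-- **The printed loop traces its flux surface exactly once** (Freidberg's hypothesis for `∮ dl`,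
`GradShafranov.IsFluxSurfaceLoop`, discharged): for `0 < r < R₀/2` and `κ, F_B, q₀ > 0`, on `[0, 2π]` the curve
`lcLoop R₀ κ r` is differentiable, closed, injective on `[0, 2π)`, and its image is exactly
`{(R, Z) : R > 0, Ψ(R, Z) = cR₀²(r² − a²)}`, `Ψ = psiLC κ F_B R₀ q₀ a`, `c = κF_B/(2R₀³q₀)`.
[cite: LeeCerfon2015, §4.1 (boundary parametrisation)] -/
theorem isFluxSurfaceLoop_lcLoop {R₀ κ FB q₀ r : ℝ} (hR₀ : 0 < R₀) (hκ : 0 < κ) (hFB : 0 < FB)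
    (hq₀ : 0 < q₀) (hr : 0 < r) (h2r : 2 * r < R₀) (a : ℝ) :
    IsFluxSurfaceLoop {x : ℝ × ℝ | 0 < x.1} (psiLC κ FB R₀ q₀ a)
      (κ * FB / (2 * R₀ ^ 3 * q₀) * (R₀ ^ 2 * (r ^ 2 - a ^ 2))) (lcLoop R₀ κ r) (2 * π) := by
  have hc : 0 < κ * FB / (2 * R₀ ^ 3 * q₀) := by positivity
  refine ⟨by positivity, ?_, ?_, ?_, ?_⟩
  · -- differentiable
    intro t
    exact ((hasDerivAt_lcLoop_fst hR₀ hr.le h2r κ t).prodMk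
      (hasDerivAt_lcLoop_snd hR₀ hr.le h2r κ t)).differentiableAt
  · -- closed
    simp only [lcLoop, lcU, Real.cos_zero, Real.sin_zero, Real.cos_two_pi, Real.sin_two_pi]
  · -- injective on [0, 2π)
    intro t₁ ht₁ t₂ ht₂ h
    have hu₁ := lcU_pos hR₀ hr.le h2r t₁
    have hu₂ := lcU_pos hR₀ hr.le h2r t₂
    simp only [lcLoop, Prod.mk.injEq] at h
    obtain ⟨h1, h2⟩ := h
    have hu : lcU R₀ r t₁ = lcU R₀ r t₂ := (Real.sqrt_inj hu₁.le hu₂.le).1 h1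
    have hcos : Real.cos t₁ = Real.cos t₂ := by
      unfold lcU at hu
      have h2r0 : 0 < 2 * r * R₀ := by positivity
      nlinarith
    have hsin : Real.sin t₁ = Real.sin t₂ := by
      rw [h1] at h2
      have hs2 : Real.sqrt (lcU R₀ r t₂) ≠ 0 := (Real.sqrt_pos.2 hu₂).ne'
      have h3 : κ * r * R₀ * Real.sin t₁ = κ * r * R₀ * Real.sin t₂ := (div_left_inj' hs2).1 h2
      have hk : κ * r * R₀ ≠ 0 := by positivity
      exact mul_left_cancel₀ hk h3
    exact tr_angle_inj ht₁ ht₂ hcos hsin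
  · -- image = level set ∩ {R > 0}
    ext ⟨R, Z⟩
    constructor
    · rintro ⟨t, -, ht⟩
      rw [← ht]
      exact ⟨Real.sqrt_pos.2 (lcU_pos hR₀ hr.le h2r t), psiLC_lcLoop hR₀ hr.le h2r hκ.ne' FB q₀ a t⟩
    · rintro ⟨hRpos, hψ⟩
      simp only [mem_setOf_eq] at hRpos hψ
      -- normalise the level-set equation
      have hlevel : 1 / 4 * (R ^ 2 - R₀ ^ 2) ^ 2 + R ^ 2 * Z ^ 2 / κ ^ 2 = r ^ 2 * R₀ ^ 2 := by
        unfold psiLC at hψ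
        have := mul_left_cancel₀ hc.ne' hψ
        linarith
      set X := (R ^ 2 - R₀ ^ 2) / (2 * r * R₀) with hX
      set Y := R * Z / (κ * r * R₀) with hY
      have hκ2 : κ ^ 2 ≠ 0 := by positivity
      have hRZ : R ^ 2 * Z ^ 2 = (r ^ 2 * R₀ ^ 2 - 1 / 4 * (R ^ 2 - R₀ ^ 2) ^ 2) * κ ^ 2 := by
        have h' : R ^ 2 * Z ^ 2 / κ ^ 2 = r ^ 2 * R₀ ^ 2 - 1 / 4 * (R ^ 2 - R₀ ^ 2) ^ 2 := by
          linarith [hlevel]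
        rwa [div_eq_iff hκ2] at h'
      have hXY : X ^ 2 + Y ^ 2 = 1 := by
        have h4 : (2 * r * R₀) ^ 2 ≠ 0 := by positivity
        have h5 : (κ * r * R₀) ^ 2 ≠ 0 := by positivity
        rw [hX, hY, div_pow, div_pow, div_add_div _ _ h4 h5, div_eq_one_iff_eq (mul_ne_zero h4 h5)]
        linear_combination (2 * r * R₀) ^ 2 * hRZ
      obtain ⟨t, ht, hct, hst⟩ := tr_exists_cos_sin hXY
      refine ⟨t, ht, ?_⟩
      have hut : lcU R₀ r t = R ^ 2 := by
        unfold lcU; rw [hct, hX]; field_simp; ring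
      have hsq : Real.sqrt (lcU R₀ r t) = R := by rw [hut, Real.sqrt_sq hRpos.le]
      simp only [lcLoop, hsq, hst, hY, Prod.mk.injEq]
      refine ⟨trivial, ?_⟩
      field_simp

end Literature.MathematicalPhysics.MHD.Solovev
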